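import Literature.NumberTheory.Transcendental.ZudilinReduction
import Literature.NumberTheory.Transcendental.ZudilinAsymptotics
import HarnessLib

/-!
# Periods family, wave 0 — proofs: Zudilin's theorem (`zudilin`)

Sibling proof file of `PeriodsWave0.lean`. It discharges the named fact
`Literature.NumberTheory.Transcendental.zudilin` (**periods.S20**; Zudilin 2001, announced in
Russian Math. Surveys 56:4, 774–776; detailed proof [Zudilin2004, §8 Theorem 3]): **at least one of
the four numbers `ζ(5), ζ(7), ζ(9), ζ(11)` is irrational** — `zudilin_holds`.

The proof assembles the two halves formalised along [Zudilin2004, §8]: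

* the arithmetic half (`ZudilinReduction.lean`, `Zudilin2004.zudilin_of_decay`): the linear forms
  `2 D_{35n}³ D_{34n} D_{33n}⁸ Sₙ ∈ Φₙ (ℤ + ℤζ(5) + ℤζ(7) + ℤζ(9) + ℤζ(11))` ([Zudilin2004, Lemma 19],
  `Zudilin2004.linearForms_arith`), the growth of the `lcm`s (prime number theorem) and of the
  arithmetic factor `Φₙ ≥ e^{176.6 n}` ([Zudilin2004, p. 270–271], `Zudilin2004.Phi_growth`),
  and the irrationality criterion (`Zudilin2004.zudilin_of_linearForms_of_lt`);
* the analytic half (`ZudilinAsymptotics.lean`): the saddle-point asymptotics of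
  [Zudilin2004, Lemma 20] — `Zudilin2004.S_decay` (`|Sₙ| ≤ e^{−c₁ n}` eventually for every
  `c₁ < 227.58`; Zudilin's `C₀ = 227.58019641…`) and `Zudilin2004.S_frequently_ne_zero`
  (`Sₙ ≠ 0` infinitely often).

With `c₁ = 227 > 226.4 = 403 − 176.6` the exponents close up:
`403 − 176.6 − 227 = −0.6 < 0` ([Zudilin2004, Proposition 5]: `C₀ > C₂`).

## References

* [Zudilin2001] W. Zudilin, *One of the numbers `ζ(5), ζ(7), ζ(9), ζ(11)` is irrational*,
  Uspekhi Mat. Nauk 56:4 (2001), 149–150; Russian Math. Surveys 56:4 (2001), 774–776.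
* [Zudilin2004] W. Zudilin, *Arithmetic of linear forms involving odd zeta values*, J. Théor.
  Nombres Bordeaux 16 (2004), 251–291, §8: Lemma 19, Lemma 20, Proposition 5, Theorem 3.
* [Fischler2004] S. Fischler, *Irrationalité de valeurs de zêta*, Sém. Bourbaki exp. 910,
  Astérisque 294 (2004), 27–62, Théorème 0.4 and §3.3.
-/

noncomputable section

namespace Literature.NumberTheory.Transcendental

/-- **Zudilin's theorem** (**periods.S20**): at least one of `ζ(5), ζ(7), ζ(9), ζ(11)` is
irrational — the discharge of the named fact `zudilin`.
[cite: Zudilin2004, §8 Theorem 3] [cite: Zudilin2001, Russian Math. Surveys 56]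
[cite: Fischler2004, Introduction, Théorème 0.4 (Zudilin)] -/
theorem zudilin_holds : zudilin :=
  Zudilin2004.zudilin_of_decay (c₁ := 227) (by norm_num) (Zudilin2004.S_decay (by norm_num))
    Zudilin2004.S_frequently_ne_zero

end Literature.NumberTheory.Transcendental
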